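import Mathlib
import Literature.Combinatorics.Optimization.PsdLiftAlgebraicBoundary
import HarnessLib

/-!
# A uniform degree bound for the algebraic boundary of psd lifts, and the number of facets of
# polytopes of bounded psd rank (FGPRT 2015, §5.2, qualitative forms — unconditional)

Sources. H. Fawzi, J. Gouveia, P. A. Parrilo, R. Z. Robinson, R. R. Thomas, *Positive semidefinite
rank*, Math. Program. 153 (2015) [FawziEtAl2015], §5.2 (held text `paper:arxiv-1407.4095`, p0016):
Proposition 5.12 ("If `C ⊆ ℝⁿ` is a full-dimensional convex semialgebraic set with a `S^k_+`-lift,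
then the degree of `C` is at most `k^{O(k²n)}`"), Corollary 5.13 ("If `C ⊂ ℝⁿ` is a full-dimensional
polytope whose slack matrix has psd rank `k`, then `C` has at most `k^{O(k²n)}` facets") and
Example 5.14 ("as the number of facets in an `n`-dimensional polytope in `ℝⁿ` increases, the psd rank
of the slack matrix of the polytope has to increase"); J. Gouveia, P. Parrilo, R. Thomas, Math. OR 38
(2013), Prop. 4.17 / Cor. 4.18 / Example 4.19.

What is here. The EXPLICIT bound `k^{O(k²n)}` rests on Renegar's quantifier elimination and is the
tree's `FawziEtAl2015_prop512_of_qe` / `FawziEtAl2015_cor513_of_qe` (file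
`PsdLiftAlgebraicBoundary.lean`, modulo the named fact `Renegar1992_qeExistentialBlock`). This file
proves, WITHOUT that fact, the qualitative-but-uniform versions:
* `HasPsdLift.exists_uniform_totalDegree_frontier`: there is a function `F(n, k)` such that every
  `C ⊆ ℝⁿ` with a psd lift of size `k` has a nonzero polynomial of total degree `≤ F(n, k)` vanishing
  on `frontier C`;
* `exists_uniform_card_facets_le_of_hasPsdFactorization_slack`: with the same kind of `F`, every
  full-dimensional polytope in `ℝⁿ` with an irredundant description by `f` inequalities whose slack
  matrix has a psd factorization of size `k` has `f ≤ F(n, k)` — so, as printed in Example 5.14, the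
  psd rank of `n`-polytopes with many facets is large (e.g. `rank_psd` of `d`-gons is unbounded).
Method (ours; the printed route is the quantitative one): by `HasPsdLift.exists_affine_coordinates`
every such `C` is `{a₀ + Λw : M₀ + Σ_t w_t B_t ⪰ 0}` with `N ≤ k²` parameters `w`; the family of ALL
these sets, with the data `(a₀, Λ, M₀, B)` as extra coordinates, is one semialgebraic set (the psd
condition is the sign test on the coefficients of the characteristic polynomial of the universal
symmetric pencil over the polynomial ring, `Matrix.charpoly_map`; the graph of `w ↦ a₀ + Λw` is
polynomial), whose projection along `w` is semialgebraic by the tree's (proved) Tarski–Seidenberg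
theorem; a sign-condition normal form of that ONE projection specialises, at each parameter point,
to a finite family of polynomials in `y ∈ ℝⁿ` of degree bounded independently of the parameters, and
the boundary of each fibre lies in the zero set of their product
(`exists_frontier_subset_zeroLocus_of_sign_determined`). The facet count is the tree's
`card_facets_le_totalDegree_of_eval_frontier_eq_zero` ("the degree of a polytope is its number of
facets") with Theorem 3.3 (`FawziEtAl2015_thm33_holds`). The bound `F` is inexplicit (it comes out
of the elimination); no new definitions or named facts.
-/

noncomputable section

open Matrix MvPolynomial Finset Set
open scoped BigOperators Polynomial

namespace Literature.Combinatorics.Optimization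

open Literature.ModelTheory.ExponentialFields (IsSemialgebraic isSemialgebraic_empty
  isSemialgebraic_setOf_eval_nonneg isSemialgebraic_setOf_eval_eq_zero)
open Literature.LinearAlgebra.Matrix.CharpolySignAlternation
  (posSemidef_iff_sign_mul_charpoly_coeff_nonneg_real)
open Literature.LinearAlgebra.Matrix (charpoly_coeff_card natDegree_charpoly_le)
open Literature.AlgebraicGeometry.RealAlgebraic (exists_frontier_subset_zeroLocus_of_sign_determined)

section Transport

/-- Over `ℝ` as its own coefficient ring, `aeval` is `eval`. [folklore] -/
private theorem aeval_eq_eval_real' {σ : Type*} (v : σ → ℝ) (p : MvPolynomial σ ℝ) :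
    aeval v p = eval v p := rfl

/-- **Projection along a block of coordinates indexed by a finite type** (Tarski–Seidenberg,
transported from `Fin (c₁ + c₂)` to a sum of finite index types): if `S ⊆ ℝ^{ι₁ ⊔ ι₂}` is
semialgebraic then so is `{u ∈ ℝ^{ι₁} : ∃ w ∈ ℝ^{ι₂}, (u, w) ∈ S}`. [folklore] -/
private theorem isSemialgebraic_setOf_exists_sum_elim {ι₁ ι₂ : Type*} [Fintype ι₁] [Fintype ι₂]
    {S : Set (ι₁ ⊕ ι₂ → ℝ)} (hS : IsSemialgebraic ℝ S) :
    IsSemialgebraic ℝ {u : ι₁ → ℝ | ∃ w : ι₂ → ℝ, Sum.elim u w ∈ S} := by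
  classical
  set c₁ := Fintype.card ι₁
  set c₂ := Fintype.card ι₂
  let e₁ : ι₁ ≃ Fin c₁ := Fintype.equivFin ι₁
  let e₂ : ι₂ ≃ Fin c₂ := Fintype.equivFin ι₂
  let ψ : ι₁ ⊕ ι₂ ≃ Fin (c₁ + c₂) := (e₁.sumCongr e₂).trans finSumFinEquiv
  have hψl : ∀ a : ι₁, ψ (Sum.inl a) = Fin.castAdd c₂ (e₁ a) := fun a => by
    simp [ψ, finSumFinEquiv_apply_left]
  have hψr : ∀ b : ι₂, ψ (Sum.inr b) = Fin.natAdd c₁ (e₂ b) := fun b => by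
    simp [ψ, finSumFinEquiv_apply_right]
  -- transport `S` to `Fin (c₁ + c₂)`, project, transport back
  have hS' : IsSemialgebraic ℝ ((fun v' : Fin (c₁ + c₂) → ℝ => v' ∘ ψ) ⁻¹' S) :=
    hS.preimage_comp ψ
  have hT' := hS'.image_castAdd
  have hU := hT'.preimage_comp (e₁.symm : Fin c₁ → ι₁)
  convert hU using 1
  ext u
  simp only [Set.mem_setOf_eq, Set.mem_preimage, Set.mem_image]
  constructor
  · rintro ⟨w, hw⟩
    refine ⟨Sum.elim u w ∘ ψ.symm, ?_, ?_⟩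
    · show (Sum.elim u w ∘ ψ.symm) ∘ ψ ∈ S
      have : (Sum.elim u w ∘ ⇑ψ.symm) ∘ ⇑ψ = Sum.elim u w := by
        funext j; simp
      rw [this]; exact hw
    · funext i
      have : ψ.symm (Fin.castAdd c₂ i) = Sum.inl (e₁.symm i) := by
        rw [Equiv.symm_apply_eq, hψl, Equiv.apply_symm_apply]
      simp only [Function.comp_apply, this, Sum.elim_inl]
  · rintro ⟨v', hv', hv'u⟩
    refine ⟨fun b => v' (ψ (Sum.inr b)), ?_⟩
    have : Sum.elim u (fun b => v' (ψ (Sum.inr b))) = v' ∘ ψ := by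
      funext j
      rcases j with a | b
      · simp only [Sum.elim_inl, Function.comp_apply, hψl]
        have := congr_fun hv'u (e₁ a)
        simp only [Function.comp_apply, Equiv.symm_apply_apply] at this
        exact this.symm
      · simp only [Sum.elim_inr, Function.comp_apply]
    rw [this]
    exact hv'

end Transport

section Uniform

/-- Substituting polynomials of total degree `≤ 1` does not raise the total degree. [folklore] -/
private theorem totalDegree_aeval_le_of_forall_le_one' {σ τ : Type*} (θ : σ → MvPolynomial τ ℝ)
    (hθ : ∀ s, (θ s).totalDegree ≤ 1) (F : MvPolynomial σ ℝ) :
    (aeval θ F).totalDegree ≤ F.totalDegree := by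
  classical
  conv_lhs => rw [F.as_sum]
  rw [map_sum]
  refine (totalDegree_finsetSum _ _).trans (Finset.sup_le fun d hd => ?_)
  rw [aeval_monomial, algebraMap_eq]
  refine (totalDegree_mul _ _).trans ?_
  rw [totalDegree_C, zero_add, Finsupp.prod]
  refine (totalDegree_finsetProd _ _).trans ?_
  calc ∑ i ∈ d.support, (θ i ^ d i).totalDegree
      ≤ ∑ i ∈ d.support, d i := Finset.sum_le_sum fun i _ =>
          (totalDegree_pow _ _).trans (by simpa using Nat.mul_le_mul_left (d i) (hθ i))
    _ ≤ F.totalDegree := by simpa [Finsupp.sum] using le_totalDegree hd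

/-- **Uniform degree bound for one parameter shape.** For fixed `n, k, N` there is `F₀` such that
for ALL data `a₀ ∈ ℝⁿ`, `Λ : ℝ^N → ℝⁿ` linear and symmetric `k × k` matrices `M₀, B_1, …, B_N`, the
boundary of `{a₀ + Λw : M₀ + Σ_t w_t B_t ⪰ 0}` lies in the zero set of a nonzero polynomial of degree
`≤ F₀`: apply Tarski–Seidenberg ONCE to the universal family (parameters as extra coordinates) and
specialise the resulting finite family of polynomials at the parameter point.
[cite: FawziEtAl2015, Prop. 5.12 (p16)] -/
private theorem exists_uniform_frontier_degree_pencil (n k N : ℕ) :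
    ∃ F₀ : ℕ, ∀ (a₀ : Fin n → ℝ) (Λ : (Fin N → ℝ) →ₗ[ℝ] (Fin n → ℝ))
      (M₀ : Matrix (Fin k) (Fin k) ℝ) (B : Fin N → Matrix (Fin k) (Fin k) ℝ),
      M₀.IsSymm → (∀ t, (B t).IsSymm) →
        ∃ P : MvPolynomial (Fin n) ℝ, P ≠ 0 ∧ P.totalDegree ≤ F₀ ∧
          ∀ y ∈ frontier ((fun w => a₀ + Λ w) '' {w | (M₀ + ∑ t, w t • B t).PosSemidef}),
            eval y P = 0 := by
  classical
  -- parameters: `a₀` | entries of `Λ` | entries of `M₀` (`none`) and of the `B_t` (`some t`)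
  let Prm := Fin n ⊕ ((Fin n × Fin N) ⊕ (Option (Fin N) × (Fin k × Fin k)))
  let I := Fin n ⊕ Prm
  let Big := I ⊕ Fin N
  -- symmetrised index
  let sym : Fin k → Fin k → Fin k × Fin k := fun a b => if a ≤ b then (a, b) else (b, a)
  have hsym : ∀ a b, sym a b = sym b a := by
    intro a b
    simp only [sym]
    rcases lt_trichotomy a b with h | h | h
    · rw [if_pos h.le, if_neg (not_le.2 h)]
    · subst h; simp
    · rw [if_neg (not_le.2 h), if_pos h.le]
  -- coordinate names
  let vy : Fin n → Big := fun l => Sum.inl (Sum.inl l)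
  let va : Fin n → Big := fun l => Sum.inl (Sum.inr (Sum.inl l))
  let vΛ : Fin n → Fin N → Big := fun l t => Sum.inl (Sum.inr (Sum.inr (Sum.inl (l, t))))
  let vM : Option (Fin N) → Fin k × Fin k → Big := fun o ab =>
    Sum.inl (Sum.inr (Sum.inr (Sum.inr (o, ab))))
  let vw : Fin N → Big := fun t => Sum.inr t
  -- the universal symmetric pencil over `ℝ[Big]`
  let Φ : Matrix (Fin k) (Fin k) (MvPolynomial Big ℝ) := Matrix.of fun a b =>
    X (vM none (sym a b)) + ∑ t, X (vw t) * X (vM (some t) (sym a b))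
  let G : Fin k → MvPolynomial Big ℝ := fun i =>
    C ((-1 : ℝ) ^ (k - (i : ℕ))) * Φ.charpoly.coeff i
  let E : Fin n → MvPolynomial Big ℝ := fun l =>
    X (vy l) - X (va l) - ∑ t, X (vΛ l t) * X (vw t)
  let W : Set (Big → ℝ) :=
    (⋂ i ∈ (Finset.univ : Finset (Fin k)), {v | 0 ≤ aeval v (G i)}) ∩
      ⋂ l ∈ (Finset.univ : Finset (Fin n)), {v | aeval v (E l) = 0}
  have hW : IsSemialgebraic ℝ W :=
    (IsSemialgebraic.biInter _ _ fun i _ => isSemialgebraic_setOf_eval_nonneg _).inter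
      (IsSemialgebraic.biInter _ _ fun l _ => isSemialgebraic_setOf_eval_eq_zero _)
  let U : Set (I → ℝ) := {u | ∃ w : Fin N → ℝ, Sum.elim u w ∈ W}
  have hU : IsSemialgebraic ℝ U := isSemialgebraic_setOf_exists_sum_elim hW
  obtain ⟨Q, T, hUQ⟩ := hU.exists_eq_setOf_signVec_mem
  refine ⟨∑ q ∈ Q, q.totalDegree, fun a₀ Λ M₀ B hM₀ hB => ?_⟩
  -- the parameter point of this lift
  let eN : Fin N → (Fin N → ℝ) := fun t j => if t = j then 1 else 0
  let θ : Prm → ℝ := Sum.elim a₀ (Sum.elim (fun lt => Λ (eN lt.2) lt.1)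
    (fun p => Option.elim p.1 (M₀ p.2.1 p.2.2) (fun t => B t p.2.1 p.2.2)))
  have hΛe : ∀ (w : Fin N → ℝ) (l : Fin n), Λ w l = ∑ t, Λ (eN t) l * w t := by
    intro w l
    rw [LinearMap.pi_apply_eq_sum_univ Λ w, Finset.sum_apply]
    exact Finset.sum_congr rfl fun t _ => by simp only [Pi.smul_apply, smul_eq_mul, mul_comm, eN]
  -- evaluation of the universal pencil at `((y, θ), w)`
  have hΦ : ∀ (y : Fin n → ℝ) (w : Fin N → ℝ),
      Φ.map (eval (Sum.elim (Sum.elim y θ) w)) = M₀ + ∑ t, w t • B t := by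
    intro y w
    ext a b
    have hMs : M₀ (sym a b).1 (sym a b).2 = M₀ a b := by
      simp only [sym]; split_ifs
      · rfl
      · exact (hM₀.apply b a).symm
    have hBs : ∀ t, B t (sym a b).1 (sym a b).2 = B t a b := by
      intro t; simp only [sym]; split_ifs
      · rfl
      · exact ((hB t).apply b a).symm
    simp only [Matrix.map_apply, Φ, Matrix.of_apply, map_add, map_sum, map_mul, eval_X, vM, vw,
      Sum.elim_inl, Sum.elim_inr, Matrix.add_apply, Matrix.sum_apply, Matrix.smul_apply, smul_eq_mul,
      θ, Option.elim, hMs, hBs, mul_comm]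
  -- `G` encodes positive semidefiniteness, `E` the graph of the affine map
  have hG : ∀ (y : Fin n → ℝ) (w : Fin N → ℝ),
      (∀ i, 0 ≤ aeval (Sum.elim (Sum.elim y θ) w) (G i)) ↔ (M₀ + ∑ t, w t • B t).PosSemidef := by
    intro y w
    set v : Big → ℝ := Sum.elim (Sum.elim y θ) w
    have hYs : (M₀ + ∑ t, w t • B t).IsSymm := by
      have h2 : (∑ t, w t • B t).IsSymm := by
        unfold Matrix.IsSymm
        rw [Matrix.transpose_sum]
        exact Finset.sum_congr rfl fun t _ => by rw [Matrix.transpose_smul, (hB t).eq]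
      exact hM₀.add h2
    have hcoeff : ∀ i : ℕ, eval v (Φ.charpoly.coeff i) = (M₀ + ∑ t, w t • B t).charpoly.coeff i := by
      intro i
      rw [← hΦ y w, Matrix.charpoly_map, Polynomial.coeff_map]
    rw [posSemidef_iff_sign_mul_charpoly_coeff_nonneg_real hYs, Fintype.card_fin]
    constructor
    · intro h j
      by_cases hj : j < k
      · have := h ⟨j, hj⟩
        rwa [aeval_eq_eval_real', map_mul, eval_C, hcoeff] at this
      · rcases (not_lt.1 hj).eq_or_lt with rfl | hlt
        · have hcard := charpoly_coeff_card (M₀ + ∑ t, w t • B t)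
          rw [Fintype.card_fin] at hcard
          rw [hcard, Nat.sub_self, pow_zero, one_mul]
          exact zero_le_one
        · have hdeg := natDegree_charpoly_le (M₀ + ∑ t, w t • B t)
          rw [Fintype.card_fin] at hdeg
          rw [Polynomial.coeff_eq_zero_of_natDegree_lt (hdeg.trans_lt hlt), mul_zero]
    · intro h i
      rw [aeval_eq_eval_real', map_mul, eval_C, hcoeff]
      exact h i
  have hE : ∀ (y : Fin n → ℝ) (w : Fin N → ℝ),
      (∀ l, aeval (Sum.elim (Sum.elim y θ) w) (E l) = 0) ↔ y = a₀ + Λ w := by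
    intro y w
    have h1 : ∀ l, aeval (Sum.elim (Sum.elim y θ) w) (E l) = y l - (a₀ + Λ w) l := by
      intro l
      rw [aeval_eq_eval_real']
      simp only [E, map_sub, map_sum, map_mul, eval_X, vy, va, vΛ, vw, Sum.elim_inl, Sum.elim_inr,
        θ, Pi.add_apply, hΛe w l]
      ring
    simp only [h1, sub_eq_zero]
    exact ⟨fun h => funext h, fun h l => by rw [h]⟩
  -- membership in the lift is membership of `(y, θ)` in the universal set
  have hmem : ∀ y : Fin n → ℝ,
      y ∈ (fun w => a₀ + Λ w) '' {w | (M₀ + ∑ t, w t • B t).PosSemidef} ↔ Sum.elim y θ ∈ U := by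
    intro y
    simp only [Set.mem_image, Set.mem_setOf_eq, U, W, Set.mem_inter_iff, Set.mem_iInter,
      Finset.mem_univ, true_implies]
    constructor
    · rintro ⟨w, hw, rfl⟩
      exact ⟨w, (hG _ w).2 hw, (hE _ w).2 rfl⟩
    · rintro ⟨w, hGw, hEw⟩
      exact ⟨w, (hG y w).1 hGw, ((hE y w).1 hEw).symm⟩
  -- specialise the describing family at `θ`
  let ρ : I → MvPolynomial (Fin n) ℝ := Sum.elim (fun l => X l) (fun p => C (θ p))
  have hρ : ∀ s, (ρ s).totalDegree ≤ 1 := by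
    rintro (l | p)
    · exact (totalDegree_X (R := ℝ) l).le
    · simp [ρ]
  have hρeval : ∀ (y : Fin n → ℝ) (q : MvPolynomial I ℝ), eval y (aeval ρ q) = aeval (Sum.elim y θ) q := by
    intro y q
    rw [MvPolynomial.aeval_eq_bind₁, show eval y = eval₂Hom (RingHom.id ℝ) y from rfl,
      MvPolynomial.eval₂Hom_bind₁, aeval_eq_eval_real', show eval (Sum.elim y θ) =
        eval₂Hom (RingHom.id ℝ) (Sum.elim y θ) from rfl]
    have hfun : (fun i => eval₂Hom (RingHom.id ℝ) y (ρ i)) = Sum.elim y θ := by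
      funext s
      rcases s with l | p
      · simp [ρ]
      · simp [ρ]
    rw [hfun]
  obtain ⟨H, hH0, hHdeg, hH⟩ := exists_frontier_subset_zeroLocus_of_sign_determined
    (fun q : Q => aeval ρ (q : MvPolynomial I ℝ))
    (S := (fun w => a₀ + Λ w) '' {w | (M₀ + ∑ t, w t • B t).PosSemidef}) (by
      intro x y hxy
      have hfun : (fun q : Q => SignType.sign (aeval (Sum.elim x θ) (q : MvPolynomial I ℝ))) =
          fun q : Q => SignType.sign (aeval (Sum.elim y θ) (q : MvPolynomial I ℝ)) := by
        funext q
        have h := hxy q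
        rwa [hρeval, hρeval] at h
      rw [hmem x, hmem y, hUQ]
      change (fun q : Q => SignType.sign (aeval (Sum.elim x θ) (q : MvPolynomial I ℝ))) ∈ T ↔
        (fun q : Q => SignType.sign (aeval (Sum.elim y θ) (q : MvPolynomial I ℝ))) ∈ T
      rw [hfun])
  refine ⟨H, hH0, hHdeg.trans ?_, hH⟩
  calc ∑ q : Q, (aeval ρ (q : MvPolynomial I ℝ)).totalDegree
      ≤ ∑ q : Q, (q : MvPolynomial I ℝ).totalDegree :=
        Finset.sum_le_sum fun q _ => totalDegree_aeval_le_of_forall_le_one' ρ hρ _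
    _ = ∑ q ∈ Q, q.totalDegree := Finset.sum_coe_sort Q fun q => q.totalDegree

/-- **Uniform (inexplicit) degree bound for the algebraic boundary of sets with a psd lift** — the
qualitative-but-uniform form of [FawziEtAl2015, Prop. 5.12], UNCONDITIONAL: there is a function
`F(n, k)` such that every `C ⊆ ℝⁿ` with a psd lift of size `k` has a nonzero polynomial of total
degree `≤ F(n, k)` vanishing on its boundary. (The printed bound `F(n,k) = k^{O(k²n)}` needs
Renegar's quantifier elimination — `FawziEtAl2015_prop512_of_qe`; here Tarski–Seidenberg, proved in
the tree, is applied once to the universal family of lifts of shape `(n, k, N)`, `N ≤ k²`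
(`HasPsdLift.exists_affine_coordinates`), which makes the degree of the specialised describing
polynomials independent of the lift.) [cite: FawziEtAl2015, Prop. 5.12 (p16)] -/
theorem HasPsdLift.exists_uniform_totalDegree_frontier :
    ∃ F : ℕ → ℕ → ℕ, ∀ (n k : ℕ) (S : Set (Fin n → ℝ)), HasPsdLift S k →
      ∃ P : MvPolynomial (Fin n) ℝ, P ≠ 0 ∧ P.totalDegree ≤ F n k ∧
        ∀ y ∈ frontier S, eval y P = 0 := by
  classical
  have key := exists_uniform_frontier_degree_pencil
  choose F₀ hF₀ using key
  refine ⟨fun n k => (Finset.range (k ^ 2 + 1)).sup (F₀ n k), fun n k S hS => ?_⟩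
  rcases S.eq_empty_or_nonempty with rfl | hne
  · exact ⟨1, one_ne_zero, by simp, by simp⟩
  obtain ⟨N, a₀, Λ, M₀, B, hN, hM₀, hB, hS'⟩ := hS.exists_affine_coordinates hne
  obtain ⟨P, hP0, hPdeg, hP⟩ := hF₀ n k N a₀ Λ M₀ B hM₀ hB
  refine ⟨P, hP0, hPdeg.trans ?_, by rw [hS']; exact hP⟩
  exact Finset.le_sup (f := F₀ n k) (Finset.mem_range.2 (by omega))

/-- **The number of facets of a polytope is bounded by a function of its dimension and the psd rank
of its slack matrix** — the qualitative form of [FawziEtAl2015, Cor. 5.13] ("as the number of facets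
in an `n`-dimensional polytope increases, the psd rank of the slack matrix of the polytope has to
increase", Example 5.14), UNCONDITIONAL with an inexplicit bound `F(n, k)`: for a full-dimensional
polytope in `ℝⁿ` with an irredundant description by `f` inequalities whose slack matrix has a psd
factorization of size `k`, `f ≤ F(n, k)` (Theorem 3.3 gives the lift, the uniform degree bound a
boundary polynomial, and `card_facets_le_totalDegree_of_eval_frontier_eq_zero` the count).
[cite: FawziEtAl2015, Cor. 5.13 and Example 5.14 (p16)] -/
theorem exists_uniform_card_facets_le_of_hasPsdFactorization_slack :
    ∃ F : ℕ → ℕ → ℕ, ∀ (n v f k : ℕ) (x : Fin v → (Fin n → ℝ)) (a : Fin f → (Fin n → ℝ))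
      (b : Fin f → ℝ), (interior (convexHull ℝ (Set.range x))).Nonempty →
      convexHull ℝ (Set.range x) = {y | ∀ j, a j ⬝ᵥ y ≤ b j} →
      (∀ j₀, {y : Fin n → ℝ | ∀ j, j ≠ j₀ → a j ⬝ᵥ y ≤ b j} ≠ {y | ∀ j, a j ⬝ᵥ y ≤ b j}) →
      HasPsdFactorization (fun i j => b j - a j ⬝ᵥ x i) k → f ≤ F n k := by
  classical
  obtain ⟨F, hF⟩ := HasPsdLift.exists_uniform_totalDegree_frontier
  refine ⟨F, fun n v f k x a b hint hVH hirr hpsd => ?_⟩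
  rcases Nat.eq_zero_or_pos k with rfl | hk
  · -- `k = 0`: the slack matrix vanishes, so inequality `j₀` is tight on `C`, which then lies in a
    -- hyperplane — impossible for a set with nonempty interior unless `f = 0`
    rcases Nat.eq_zero_or_pos f with hf0 | hf
    · omega
    · exfalso
      obtain ⟨p, hp⟩ := hint
      obtain ⟨A, B', -, -, hS⟩ := hpsd
      set j₀ : Fin f := ⟨0, hf⟩
      have hon : ∀ i, a j₀ ⬝ᵥ x i = b j₀ := fun i => by
        have := hS i j₀
        simp only [Matrix.trace, Finset.univ_eq_empty, Finset.sum_empty] at this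
        linarith
      have hconv : Convex ℝ {y : Fin n → ℝ | a j₀ ⬝ᵥ y = b j₀} := by
        intro y hy z hz α β _ _ hαβ
        simp only [Set.mem_setOf_eq] at hy hz ⊢
        rw [dotProduct_add, dotProduct_smul, dotProduct_smul, hy, hz, smul_eq_mul, smul_eq_mul,
          ← add_mul, hαβ, one_mul]
      have hsub : convexHull ℝ (Set.range x) ⊆ {y | a j₀ ⬝ᵥ y = b j₀} :=
        convexHull_min (Set.range_subset_iff.mpr hon) hconv
      have ha0 : a j₀ ≠ 0 := by
        intro hj
        apply hirr j₀
        ext y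
        simp only [Set.mem_setOf_eq]
        refine ⟨fun hy i => ?_, fun hy i _ => hy i⟩
        by_cases hij : i = j₀
        · subst hij
          have hpQ : p ∈ {y : Fin n → ℝ | ∀ j, a j ⬝ᵥ y ≤ b j} := hVH ▸ interior_subset hp
          have := hpQ j₀
          rw [hj, zero_dotProduct] at this ⊢
          exact this
        · exact hy i hij
      have hcont : Continuous fun t : ℝ => p + t • a j₀ :=
        continuous_const.add (continuous_id.smul continuous_const)
      have hev : ∀ᶠ t in nhds (0 : ℝ), p + t • a j₀ ∈ convexHull ℝ (Set.range x) := by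
        have h0 : convexHull ℝ (Set.range x) ∈ nhds (p + (0 : ℝ) • a j₀) := by
          rw [zero_smul, add_zero]; exact mem_interior_iff_mem_nhds.mp hp
        exact hcont.continuousAt.preimage_mem_nhds h0
      obtain ⟨t, htC, ht⟩ :=
        ((hev.filter_mono nhdsWithin_le_nhds).and (eventually_mem_nhdsWithin (s := Set.Ioi 0))).exists
      have h1 : a j₀ ⬝ᵥ (p + t • a j₀) = b j₀ := hsub htC
      have h0 : a j₀ ⬝ᵥ p = b j₀ := hsub (interior_subset hp)
      rw [dotProduct_add, dotProduct_smul, smul_eq_mul, h0] at h1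
      have h2 : 0 < a j₀ ⬝ᵥ a j₀ :=
        lt_of_le_of_ne (Finset.sum_nonneg fun i _ => mul_self_nonneg _)
          (Ne.symm (mt dotProduct_self_eq_zero.mp ha0))
      have ht0 : (0 : ℝ) < t := ht
      nlinarith [mul_pos ht0 h2]
  · have hlift : HasPsdLift (convexHull ℝ (Set.range x)) k :=
      (FawziEtAl2015_thm33_holds n v f k x a b hk hVH).mp hpsd
    obtain ⟨P, hP0, hPdeg, hPfr⟩ := hF n k _ hlift
    exact (card_facets_le_totalDegree_of_eval_frontier_eq_zero x a b hint hVH hirr hP0 hPfr).trans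
      hPdeg

/-- **FGPRT Example 5.14, qualitative and unconditional** ("Corollary 5.13 shows that as the
number of facets in an `n`-dimensional polytope in `ℝⁿ` increases, the psd rank of the slack matrix
of the polytope has to increase … `rank_psd(S_d)` grows to infinity as `d` increases"): for every
dimension `n` and size `k` there is `f₀` such that NO full-dimensional polytope in `ℝⁿ` with an
irredundant description by `f ≥ f₀` inequalities has a slack matrix with a psd factorization of size
`k` (i.e. `rank_psd > k` once the facet count reaches `f₀`). [cite: FawziEtAl2015, Example 5.14 (p16)] -/
theorem FawziEtAl2015_ex514 (n k : ℕ) :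
    ∃ f₀ : ℕ, ∀ (v f : ℕ) (x : Fin v → (Fin n → ℝ)) (a : Fin f → (Fin n → ℝ)) (b : Fin f → ℝ),
      f₀ ≤ f → (interior (convexHull ℝ (Set.range x))).Nonempty →
      convexHull ℝ (Set.range x) = {y | ∀ j, a j ⬝ᵥ y ≤ b j} →
      (∀ j₀, {y : Fin n → ℝ | ∀ j, j ≠ j₀ → a j ⬝ᵥ y ≤ b j} ≠ {y | ∀ j, a j ⬝ᵥ y ≤ b j}) →
      ¬ HasPsdFactorization (fun i j => b j - a j ⬝ᵥ x i) k := by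
  obtain ⟨F, hF⟩ := exists_uniform_card_facets_le_of_hasPsdFactorization_slack
  refine ⟨F n k + 1, fun v f x a b hf hint hVH hirr hpsd => ?_⟩
  have := hF n v f k x a b hint hVH hirr hpsd
  omega

end Uniform

end Literature.Combinatorics.Optimization
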